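import Summits.AnomalousDissipation.AnomalousDissipation.Theorems.SolenoidalFractalHomogenisationRealisedQuasiStaticCellLawPrincipalCosetDecay
import Summits.AnomalousDissipation.AnomalousDissipation.Theorems.SolenoidalFractalHomogenisationRealisedQuasiStaticCellLawRestBlock
import Summits.AnomalousDissipation.AnomalousDissipation.Theorems.SolenoidalFractalHomogenisationRealisedQuasiStaticCellLawCosetGeometry
import Summits.AnomalousDissipation.AnomalousDissipation.Theorems.SolenoidalFractalHomogenisationRealisedQuasiStaticCellLawOutOfPlaneLadder
import Literature.Analysis.FunctionSpaces.TorusHeatSmoothing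
import Literature.Analysis.FunctionSpaces.TorusPeriodicLocalization
import HarnessLib

/-!
# K2R `RealisedQuasiStaticCellLaw`, line `floquet-bloch`: contraction of the TOTAL energy of the Galerkin truncation of a low
# Bloch sector across one good slot window (helper towards `stub_lowSectorDecay`; `--supports stmt-AnomalousDissipation-20446`)

Summits-side helper file (everything proved; no definitions, no named facts). The far-sector bookkeeping step of STUB-PLAN
`stub_lowSectorDecay` §3.5 for ONE window: the modes of `freqBall N` split into the two principal cosets `±ℓ + ℤK_j`
(images of the index segment) and the rest `F`; the principal coset `ℓ + ℤK_j` contracts at the enhanced rate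
(`principalCoset_decay`), its conjugate carries the same energy (`norm_galerkinCoeffAt_neg`), and `F` is a symmetric
`K_j`-invariant block on which the truncation vanishes below `|k| < n/2` (sector structure, `2|ℓ| ≤ n`), so it decays at the
standard rate `e^{-8π²κ(n/2)²(t-t₀)}` (`restBlock_decay_slot`). Result (`sectorWindow_contraction`):
`E_N(t) ≤ max(2·(5/3)·e^{-r_P (t-t₀)}, e^{-2π²κ n² (t-t₀)/… })·E_N(t₀)` with `E_N(t) = ∑_{k ∈ freqBall N} ‖α_N(t)(k)‖²` — the
input of `exp_decay_of_window_contraction` (§3.6).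
-/

set_option linter.dupNamespace false

noncomputable section

namespace Summit.AnomalousDissipation.AnomalousDissipation.Theorems.SolenoidalFractalHomogenisation.RealisedQuasiStaticCellLaw

open Set MeasureTheory Filter Topology Function Matrix
open scoped InnerProductSpace ComplexConjugate Matrix
open Literature.Analysis Literature.Analysis.FunctionSpaces Literature.Analysis.FunctionSpaces.Torus
open Literature.Analysis.FluidPDE Literature.Analysis.FluidPDE.LatticeShear

variable {k₀ : ℕ}

/-- A sector mode `±ℓ + n•z` with `z ≠ 0` and `2|ℓ| ≤ n` has `|k| ≥ n/2`. -/
theorem half_le_norm_of_sector {ℓ z k : Fin 3 → ℤ} {n : ℕ} (hz : z ≠ 0) (hℓn : 2 * ‖latticeVec ℓ‖ ≤ n)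
    (hk : k = ℓ + (n : ℤ) • z ∨ k = -ℓ + (n : ℤ) • z) : ((n : ℝ) / 2) ^ 2 ≤ freqNormSq k := by
  rw [← norm_latticeVec_sq]
  have hz1 : 1 ≤ ‖latticeVec z‖ := one_le_norm_latticeVec hz
  have hn0 : (0 : ℝ) ≤ n := Nat.cast_nonneg n
  have hnz : latticeVec ((n : ℤ) • z) = (n : ℝ) • latticeVec z := by
    ext i; simp [latticeVec_apply]
  have hlow : (n : ℝ) / 2 ≤ ‖latticeVec k‖ := by
    rcases hk with rfl | rfl
    · rw [latticeVec_add, hnz]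
      have h1 := norm_sub_norm_le ((n : ℝ) • latticeVec z) (-latticeVec ℓ)
      rw [norm_smul, Real.norm_eq_abs, abs_of_nonneg hn0, norm_neg, sub_neg_eq_add, add_comm] at h1
      nlinarith
    · rw [latticeVec_add, hnz]
      have h1 := norm_sub_norm_le ((n : ℝ) • latticeVec z) (latticeVec ℓ)
      rw [norm_smul, Real.norm_eq_abs, abs_of_nonneg hn0] at h1
      have e : (n : ℝ) • latticeVec z - latticeVec ℓ = latticeVec (-ℓ) + (n : ℝ) • latticeVec z := by
        have : latticeVec (-ℓ) = -latticeVec ℓ := by ext i; simp [latticeVec_apply]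
        rw [this]; abel
      rw [e] at h1
      nlinarith
  have h0 : 0 ≤ (n : ℝ) / 2 := by positivity
  nlinarith [mul_self_le_mul_self h0 hlow]

/-- **Contraction of the total truncation energy of a low sector across one good slot window.** -/
theorem sectorWindow_contraction (W : LatticeWord k₀) {n : ℕ} (hn : 0 < n) {κ : ℝ} (hκ : 0 < κ)
    (ℓ : Fin 3 → ℤ) (hℓn : 2 * ‖latticeVec ℓ‖ ≤ n) {w₀ : UnitAddTorus (Fin 3) → EuclideanSpace ℝ (Fin 3)}
    (hw₀ : FunctionSpaces.Torus.MemSobolev 1 (FunctionSpaces.EuclideanSpace.complexify ∘ w₀))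
    (hdiv : FunctionSpaces.Torus.IsWeaklyDivFree w₀) (hmean : FunctionSpaces.Torus.HasZeroMean w₀)
    (hsupp : ∀ k : Fin 3 → ℤ, ¬ ((∃ z : Fin 3 → ℤ, k = ℓ + (n:ℤ) • z) ∨ (∃ z : Fin 3 → ℤ, k = -ℓ + (n:ℤ) • z)) →
      UnitAddTorus.mFourierCoeff (FunctionSpaces.EuclideanSpace.complexify ∘ w₀) k = 0)
    {N : ℕ} (hBN : (Finset.univ.biUnion fun j : Fin k₀ =>
        ({(fun i => (W.phase j).m i * n), -(fun i => (W.phase j).m i * n)} : Finset (Fin 3 → ℤ))) ⊆ freqBall N)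
    {T t₀ t₁ : ℝ} (ht₀ : 0 ≤ t₀) (ht₁T : t₁ ≤ T) (ht₀₁ : t₀ ≤ t₁) (j : Fin k₀)
    (hwin : ∀ t ∈ Icc t₀ t₁, Int.fract (t / W.period) * W.period ∈ Icc (W.start j) (W.start j + (W.phase j).τ))
    (hk : ∀ J : ℤ, ℓ + J • (fun i => (W.phase j).m i * (n : ℤ)) ∈ freqBall N →
      ℓ + J • (fun i => (W.phase j).m i * (n : ℤ)) ≠ 0)
    {ζr : Fin 3 → ℝ} (hζ1 : ζr ⬝ᵥ ζr = 1) (hζ0 : ζr ⬝ᵥ (fun i => ((ℓ i : ℤ) : ℝ)) = 0)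
    (hζK : ζr ⬝ᵥ (fun i => (((fun i => (W.phase j).m i * (n : ℤ)) i : ℤ) : ℝ)) = 0)
    {p : ℤ → Fin 3 → ℝ}
    (hp : ∀ J : ℤ, p J = (Real.sqrt ((fun i => (((ℓ + J • (fun i => (W.phase j).m i * (n : ℤ))) i : ℤ) : ℝ)) ⬝ᵥ
        (fun i => (((ℓ + J • (fun i => (W.phase j).m i * (n : ℤ))) i : ℤ) : ℝ))))⁻¹ •
        (fun i => (((ℓ + J • (fun i => (W.phase j).m i * (n : ℤ))) i : ℤ) : ℝ)) ⨯₃ ζr)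
    {Wset : Finset ℤ} (hW : ∀ J : ℤ, J ∈ Wset ↔ ℓ + J • (fun i => (W.phase j).m i * (n : ℤ)) ∈ freqBall N)
    (h0 : (0 : ℤ) ∈ Wset) (h1 : (1 : ℤ) ∈ Wset) (hm1 : (-1 : ℤ) ∈ Wset)
    (hs : ∀ J ∈ Wset, |p J ⬝ᵥ p (J + 1)| ≤ 1) (hγpos : 0 < (p 0 ⬝ᵥ p 1) ^ 2 + (p (-1) ⬝ᵥ p 0) ^ 2)
    (hd0 : freqNormSq ℓ / freqNormSq (fun i => (W.phase j).m i * (n : ℤ)) ≤ 1)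
    (hd : ∀ J ∈ Wset, J ≠ 0 →
      1 / 2 ≤ freqNormSq (ℓ + J • (fun i => (W.phase j).m i * (n : ℤ))) / freqNormSq (fun i => (W.phase j).m i * (n : ℤ)))
    (hd1 : freqNormSq (ℓ + (1 : ℤ) • (fun i => (W.phase j).m i * (n : ℤ))) /
      freqNormSq (fun i => (W.phase j).m i * (n : ℤ)) ≤ 2)
    (hdm1 : freqNormSq (ℓ + (-1 : ℤ) • (fun i => (W.phase j).m i * (n : ℤ))) /
      freqNormSq (fun i => (W.phase j).m i * (n : ℤ)) ≤ 2)
    {g_lo g_hi : ℝ} (hglo : 0 < g_lo) (hghi : g_lo ≤ g_hi)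
    (hg : ∀ t ∈ Ioo t₀ t₁,
      g_lo ≤ 2 * Real.pi * (∑ i, (W.phase j).e i * (ℓ i : ℝ)) *
          ‖Complex.exp ((W.phase j).φ * Complex.I) *
            (1 / (2 * ((2 * Real.pi * ‖latticeVec (W.phase j).m‖ : ℝ) : ℂ) * Complex.I))‖ *
          ((1 / (n : ℝ)) * LatticeWord.trapezoid (W.start j) (W.phase j).τ W.ramp (Int.fract (t / W.period) * W.period)) /
        (κ * (4 * Real.pi ^ 2 * freqNormSq (fun i => (W.phase j).m i * (n : ℤ)))) ∧
      2 * Real.pi * (∑ i, (W.phase j).e i * (ℓ i : ℝ)) *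
          ‖Complex.exp ((W.phase j).φ * Complex.I) *
            (1 / (2 * ((2 * Real.pi * ‖latticeVec (W.phase j).m‖ : ℝ) : ℂ) * Complex.I))‖ *
          ((1 / (n : ℝ)) * LatticeWord.trapezoid (W.start j) (W.phase j).τ W.ramp (Int.fract (t / W.period) * W.period)) /
        (κ * (4 * Real.pi ^ 2 * freqNormSq (fun i => (W.phase j).m i * (n : ℤ)))) ≤ g_hi) :
    ∑ k ∈ freqBall N, ‖(pvSetup_cell W hn hκ.le ℓ hw₀ hdiv hmean hsupp).galerkinCoeffAt N t₁ k‖ ^ 2 ≤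
      max (2 * (5 / 3) * Real.exp (-(κ * (4 * Real.pi ^ 2 * freqNormSq (fun i => (W.phase j).m i * (n : ℤ))) *
            min 2 ((p 0 ⬝ᵥ p 1) ^ 2 + (p (-1) ⬝ᵥ p 0) ^ 2) * g_lo * min g_lo g_hi⁻¹ / 80) * (t₁ - t₀)))
          (Real.exp (-(8 * Real.pi ^ 2 * κ * ((n : ℝ) / 2) ^ 2) * (t₁ - t₀))) *
        ∑ k ∈ freqBall N, ‖(pvSetup_cell W hn hκ.le ℓ hw₀ hdiv hmean hsupp).galerkinCoeffAt N t₀ k‖ ^ 2 := by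
  classical
  have ht₁ : t₁ ∈ Icc t₀ t₁ := ⟨ht₀₁, le_rfl⟩
  -- the principal coset contracts at the enhanced rate
  have hP := principalCoset_decay W hn hκ ℓ hw₀ hdiv hmean hsupp hBN ht₀ ht₁T j hwin ℓ hk hζ1 hζ0 hζK hp hW h0 h1 hm1 hs
    hγpos hd0 hd hd1 hdm1 hglo hghi hg t₁ ht₁
  set hPV := pvSetup_cell W hn hκ.le ℓ hw₀ hdiv hmean hsupp with hPVdef
  set K : Fin 3 → ℤ := fun i => (W.phase j).m i * (n : ℤ) with hK
  set θP : ℝ := 5 / 3 * Real.exp (-(κ * (4 * Real.pi ^ 2 * freqNormSq K) *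
    min 2 ((p 0 ⬝ᵥ p 1) ^ 2 + (p (-1) ⬝ᵥ p 0) ^ 2) * g_lo * min g_lo g_hi⁻¹ / 80) * (t₁ - t₀)) with hθP
  set θF : ℝ := Real.exp (-(8 * Real.pi ^ 2 * κ * ((n : ℝ) / 2) ^ 2) * (t₁ - t₀)) with hθF
  have hθP0 : 0 ≤ θP := by positivity
  have hθF0 : 0 ≤ θF := by positivity
  have hK0 : K ≠ 0 := cellFreq_ne_zero (W.phase j) hn
  -- the partition of the ball
  set E : ℝ → (Fin 3 → ℤ) → ℝ := fun τ k => ‖hPV.galerkinCoeffAt N τ k‖ ^ 2 with hE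
  have hE0 : ∀ τ k, 0 ≤ E τ k := fun τ k => by positivity
  set Pp : Finset (Fin 3 → ℤ) := Wset.image (fun J : ℤ => ℓ + J • K) with hPp
  set Pm : Finset (Fin 3 → ℤ) := Pp.image (fun k => -k) with hPm
  set U : Finset (Fin 3 → ℤ) := Pp ∪ Pm with hU
  set F : Finset (Fin 3 → ℤ) := freqBall N \ U with hF
  have hPpS : Pp ⊆ freqBall N := by
    intro k hk'
    obtain ⟨J, hJ, rfl⟩ := Finset.mem_image.1 hk'
    exact (hW J).1 hJ
  have hPmS : Pm ⊆ freqBall N := by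
    intro k hk'
    obtain ⟨k', hk'P, rfl⟩ := Finset.mem_image.1 hk'
    exact neg_mem_freqBall_of_mem _ (hPpS hk'P)
  have hUS : U ⊆ freqBall N := Finset.union_subset hPpS hPmS
  -- sums over the pieces
  have hsplit : ∀ τ, ∑ k ∈ freqBall N, E τ k = ∑ k ∈ U, E τ k + ∑ k ∈ F, E τ k := by
    intro τ; rw [add_comm, hF, Finset.sum_sdiff hUS]
  have hPp_sum : ∀ τ, ∑ k ∈ Pp, E τ k = ∑ J ∈ Wset, E τ (ℓ + J • K) := by
    intro τ; rw [hPp, Finset.sum_image (fun J _ J' _ h => coset_injective hK0 ℓ h)]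
  have hPm_sum : ∀ τ, ∑ k ∈ Pm, E τ k = ∑ k ∈ Pp, E τ k := by
    intro τ
    rw [hPm, Finset.sum_image (fun k _ k' _ h => neg_injective h)]
    refine Finset.sum_congr rfl fun k _ => ?_
    simp only [hE]
    rw [norm_galerkinCoeffAt_neg W hn hκ.le ℓ hw₀ hdiv hmean hsupp]
  have hU_le : ∀ τ, ∑ k ∈ U, E τ k ≤ 2 * ∑ k ∈ Pp, E τ k := by
    intro τ
    have h := Finset.sum_union_inter (s₁ := Pp) (s₂ := Pm) (f := E τ)
    have hint : 0 ≤ ∑ k ∈ Pp ∩ Pm, E τ k := Finset.sum_nonneg fun k _ => hE0 τ k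
    rw [hPm_sum τ] at h
    rw [hU]; linarith
  have hPp_le_U : ∀ τ, ∑ k ∈ Pp, E τ k ≤ ∑ k ∈ U, E τ k := fun τ =>
    Finset.sum_le_sum_of_subset_of_nonneg Finset.subset_union_left fun k _ _ => hE0 τ k
  -- the rest block `F`
  have hFS : F ⊆ freqBall N := Finset.sdiff_subset
  have hmemPp : ∀ J : ℤ, ℓ + J • K ∈ freqBall N → ℓ + J • K ∈ Pp := fun J hJ =>
    Finset.mem_image.2 ⟨J, (hW J).2 hJ, rfl⟩
  have hmemPm : ∀ J : ℤ, ℓ + J • K ∈ freqBall N → -(ℓ + J • K) ∈ Pm := fun J hJ =>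
    Finset.mem_image.2 ⟨ℓ + J • K, hmemPp J hJ, rfl⟩
  have hUsymm : ∀ k ∈ U, -k ∈ U := by
    intro k hk'
    rw [hU, Finset.mem_union] at hk' ⊢
    rcases hk' with h | h
    · exact Or.inr (Finset.mem_image.2 ⟨k, h, rfl⟩)
    · obtain ⟨k', hk'P, rfl⟩ := Finset.mem_image.1 h
      rw [neg_neg]; exact Or.inl hk'P
  have hFsymm : ∀ k ∈ F, -k ∈ F := by
    intro k hk'
    rw [hF, Finset.mem_sdiff] at hk' ⊢
    refine ⟨neg_mem_freqBall_of_mem _ hk'.1, fun h => hk'.2 ?_⟩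
    have := hUsymm _ h
    rwa [neg_neg] at this
  -- `U` is `K`-invariant inside the ball, hence so is `F`
  have hUadd : ∀ k, k + K ∈ U → k ∈ freqBall N → k ∈ U := by
    intro k hkU hkS
    rw [hU, Finset.mem_union] at hkU ⊢
    rcases hkU with h | h
    · obtain ⟨J, _, hJk⟩ := Finset.mem_image.1 h
      have hk' : k = ℓ + (J - 1) • K := by rw [sub_smul, one_smul, ← add_sub_assoc, hJk]; abel
      rw [hk'] at hkS ⊢
      exact Or.inl (hmemPp _ hkS)
    · obtain ⟨k', hk'P, hk'eq⟩ := Finset.mem_image.1 h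
      obtain ⟨J, _, hJk⟩ := Finset.mem_image.1 hk'P
      have hk' : k = -(ℓ + (J + 1) • K) := by
        rw [add_smul, one_smul, ← add_assoc, hJk, neg_add, hk'eq]; abel
      rw [hk'] at hkS ⊢
      have hkS' : ℓ + (J + 1) • K ∈ freqBall N := by
        have := neg_mem_freqBall_of_mem _ hkS
        rwa [neg_neg] at this
      exact Or.inr (hmemPm _ hkS')
  have hUsub : ∀ k, k - K ∈ U → k ∈ freqBall N → k ∈ U := by
    intro k hkU hkS
    have h1 : -k + K ∈ U := by
      have := hUsymm _ hkU
      rwa [neg_sub, sub_eq_neg_add] at this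
    have h2 := hUadd (-k) h1 (neg_mem_freqBall_of_mem _ hkS)
    have := hUsymm _ h2
    rwa [neg_neg] at this
  have hFadd : ∀ k ∈ F, k + K ∈ freqBall N → k + K ∈ F := by
    intro k hkF hkS
    rw [hF, Finset.mem_sdiff] at hkF ⊢
    exact ⟨hkS, fun h => hkF.2 (hUadd k h hkF.1)⟩
  have hFsub : ∀ k ∈ F, k - K ∈ freqBall N → k - K ∈ F := by
    intro k hkF hkS
    rw [hF, Finset.mem_sdiff] at hkF ⊢
    exact ⟨hkS, fun h => hkF.2 (hUsub k h hkF.1)⟩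
  -- the truncation vanishes on `F` below `|k| < n/2`
  have hR : ∀ τ ∈ Icc t₀ t₁, ∀ k ∈ F, freqNormSq k < ((n : ℝ) / 2) ^ 2 → hPV.galerkinCoeffAt N τ k = 0 := by
    intro τ _ k hkF hlt
    by_cases hsec : k ∈ ({k | (∃ z : Fin 3 → ℤ, k = ℓ + (n:ℤ) • z) ∨ (∃ z : Fin 3 → ℤ, k = -ℓ + (n:ℤ) • z)} :
        Set (Fin 3 → ℤ))
    · exfalso
      rw [hF, Finset.mem_sdiff] at hkF
      rcases hsec with ⟨z, hz⟩ | ⟨z, hz⟩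
      · by_cases hz0 : z = 0
        · subst hz0
          have hkℓ : k = ℓ + (0 : ℤ) • K := by rw [hz]; simp
          exact hkF.2 (by rw [hU, Finset.mem_union]; exact Or.inl (hkℓ ▸ hmemPp 0 (hkℓ ▸ hkF.1)))
        · exact absurd hlt (not_lt.2 (half_le_norm_of_sector hz0 hℓn (Or.inl hz)))
      · by_cases hz0 : z = 0
        · subst hz0
          have hkℓ : k = -(ℓ + (0 : ℤ) • K) := by rw [hz]; simp
          have hℓS : ℓ + (0 : ℤ) • K ∈ freqBall N := by
            have := neg_mem_freqBall_of_mem _ hkF.1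
            rwa [hkℓ, neg_neg] at this
          exact hkF.2 (by rw [hU, Finset.mem_union]; exact Or.inr (hkℓ ▸ hmemPm 0 hℓS))
        · exact absurd hlt (not_lt.2 (half_le_norm_of_sector hz0 hℓn (Or.inr hz)))
    · exact hPV.galerkinCoeffAt_eq_zero N τ (Or.inl hsec)
  have hFdec := restBlock_decay_slot W hn hκ.le ℓ hw₀ hdiv hmean hsupp hBN ht₀ ht₁T j hwin hFS hFsymm hFadd hFsub hR t₁ ht₁
  -- assemble
  have hP' : ∑ J ∈ Wset, E t₁ (ℓ + J • K) ≤ θP * ∑ J ∈ Wset, E t₀ (ℓ + J • K) := by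
    simpa only [hE, hθP, mul_assoc] using hP
  have hF' : ∑ k ∈ F, E t₁ k ≤ θF * ∑ k ∈ F, E t₀ k := by simpa only [hE, hθF] using hFdec
  have hmaxP : 2 * θP ≤ max (2 * θP) θF := le_max_left _ _
  have hmaxF : θF ≤ max (2 * θP) θF := le_max_right _ _
  have hUt0 : 0 ≤ ∑ k ∈ U, E t₀ k := Finset.sum_nonneg fun k _ => hE0 t₀ k
  have hFt0 : 0 ≤ ∑ k ∈ F, E t₀ k := Finset.sum_nonneg fun k _ => hE0 t₀ k
  have hgoal : ∑ k ∈ freqBall N, E t₁ k ≤ max (2 * θP) θF * ∑ k ∈ freqBall N, E t₀ k := by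
    rw [hsplit t₁, hsplit t₀, mul_add]
    refine add_le_add ?_ ?_
    · calc ∑ k ∈ U, E t₁ k ≤ 2 * ∑ k ∈ Pp, E t₁ k := hU_le t₁
        _ = 2 * ∑ J ∈ Wset, E t₁ (ℓ + J • K) := by rw [hPp_sum]
        _ ≤ 2 * (θP * ∑ J ∈ Wset, E t₀ (ℓ + J • K)) := by linarith
        _ = (2 * θP) * ∑ k ∈ Pp, E t₀ k := by rw [hPp_sum]; ring
        _ ≤ (2 * θP) * ∑ k ∈ U, E t₀ k := mul_le_mul_of_nonneg_left (hPp_le_U t₀) (by positivity)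
        _ ≤ max (2 * θP) θF * ∑ k ∈ U, E t₀ k := mul_le_mul_of_nonneg_right hmaxP hUt0
    · calc ∑ k ∈ F, E t₁ k ≤ θF * ∑ k ∈ F, E t₀ k := hF'
        _ ≤ max (2 * θP) θF * ∑ k ∈ F, E t₀ k := mul_le_mul_of_nonneg_right hmaxF hFt0
  have e2 : 2 * θP = 2 * (5 / 3) * Real.exp (-(κ * (4 * Real.pi ^ 2 * freqNormSq K) *
      min 2 ((p 0 ⬝ᵥ p 1) ^ 2 + (p (-1) ⬝ᵥ p 0) ^ 2) * g_lo * min g_lo g_hi⁻¹ / 80) * (t₁ - t₀)) := by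
    rw [hθP]; ring
  rw [e2] at hgoal
  simpa only [hE] using hgoal

end Summit.AnomalousDissipation.AnomalousDissipation.Theorems.SolenoidalFractalHomogenisation.RealisedQuasiStaticCellLaw

end
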